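import Literature.NumberTheory.LFunctions.Zhang2022.KnifeEdgeEStarLen

/-!
# Zhang (2022), rung F-S3 (Landau–Siegel programme, family B-len): the off-diagonal form `X` —
# scalar coordinates of a two-piece design and its closing criteria (proved), the axioms `OffDiagForm`
# (definition request D-len-1), `C`-boundedness and the ROBUST closing criterion (proved), the canonical
# inhabitant `invisibleForm` (proved), and registry row E-002 `E*-len⁺(X)` typed

Y. Zhang, *Discrete mean estimates and the Landau–Siegel zero*, arXiv:2211.02515v1 [Zhang2022LandauSiegel] —
an unrefereed manuscript under adjudication. **WHAT THIS IS NOT: not a claim about Theorems 1–2 of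
arXiv:2211.02515, about Landau–Siegel zeros, or about Parity. The programme SEARCHES and TYPES; nothing here
asserts any estimate: `OffDiagForm`, `OffDiagBoundedOn`, `RobustMargin`, `EStarLenPlusShape`,
`ClosesByPositivityIn`, `EStarLenPlusBounded` are bare `Prop`s / predicates (cell `obj/EDREGISTRY.md` row E-002,
definition request D-len-1 of `OBJECTIVE.md` §3.4), and every `theorem` is either elementary algebra about them or an
implication into the named nodes of `SkeletonPropositions`.**

Language: the two-piece design `s·u ⊕ v` of `KnifeEdgeOverhangRankOne` — `u` an in-class piece (`InClassPiece`,
logarithmic support `[0,1]`, i.e. `n ≤ P`), `v` an overhang piece of length `θ` (`OverhangPiece θ`, or any other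
class `𝒱`), amplitude `s ∈ ℂ`; its would-be main constant in the `X`-world is
`q_X(s) = twoPieceMainTerm θ X u u′ v v′ s = |s|²𝔅(u) + 2Re(s·(πΦ̄_vL(u) + X(u,v))) + Re 𝔅_θ(v) + 2Re X(v,v)`,
`X : PairFunctional` the slot for the off-diagonal main term of the classes `n ≡ m (mod p)`, `n ≠ m`
((7.2), Prop 7.1: absent for lengths `≤ P`; OPEN IN PRINT beyond).

**Part 1 (proved).** Scalar coordinates `crossCoeff θ X u u′ v v′ = tailCoupling θ u v + X(u,v)` (`ℂ`) and
`overhangConst θ X v v′ = Re 𝔅_θ(v) + 2Re X(v,v)` (`ℝ`), `twoPieceMainTerm = |s|²𝔅(u) + 2Re(s·crossCoeff) +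
overhangConst` (`twoPieceMainTerm_eq`), and the CLOSING CRITERIA of the real quadratic `a|s|² + 2Re(sc) + k`
(`a = 𝔅(u) ≥ 0` in class, `MainTermFormH1.mainTermForm_nonneg_of_isH1`): `a > 0 ⇒ ((∃ s, q < 0) ↔ k·a < |c|²)`;
`a = 0 ⇒ ((∃ s, q < 0) ↔ c ≠ 0 ∨ k < 0)`; `k < 0 ⇒ q(0) < 0`; all together `closes_iff` — the cell's «X-pricing»
rows (`ρ = |c|²/(𝔅(u)·Re 𝔅_θ(v))`) as kernel lemmas.

**Part 2 (definition request D-len-1).** `structure OffDiagForm θ X : Prop` — the axioms a derivation of the true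
`X` would deliver and that the two-piece bookkeeping uses: `below_wall` (no off-diagonal MAIN term between two
in-class pieces — this encodes (7.2) + Prop 7.1 as an AXIOM ON THE CANDIDATE `X`; for the audited class R it is a
theorem of the tree via the p428635 chain `Repair.not_repairable_true_need`, and the coupling of an in-class piece
with an overhang in the continued calculus is `KnifeEdge.rankOneTailCoupling_holds`; for R⁺ ∖ R nothing in the
tree or in print asserts it), `smul_left` (homogeneous in the first piece), `smul_right` (conjugate-homogeneous in
the second). NO Hermitian field: `twoPieceMainTerm` reads `X` only through `X(u,v)` and `X(v,v)` (the `X(v,u)` slot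
is silent, exactly as `M_θ(v,u) = 0` in `rankOneTailCoupling_holds`), so the completed form IS the Hermitian form
with those entries. Additivity in each slot (needed only by `k ≥ 3`-piece `X`-designs) is deliberately left to a
second predicate (append-only). Existence is NOT smuggled: the construction of the true `X` is row E-002.

**Part 3 (proved).** `OffDiagBoundedOn θ C X 𝒱`: on designs `(u,v)`, `u` in class, `v ∈ 𝒱`,
`|X(u,v)| ≤ C·N₁(u)·N_θ(v)` and `|Re X(v,v)| ≤ C·N_θ(v)²` with the `H¹`-type sizes
`N₁(u) = inClassNorm u u′ = (∫₀¹ |u|² + |u′|²)^{1/2}`, `N_θ(v) = overhangNorm θ v v′ = (∫₁^θ |v|² + |v′|²)^{1/2}`.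
`RobustMargin θ C u u′ v v′` is the ELEMENTARY inequality in the five certified atoms of a design
(`a = 𝔅(u)`, `c₀ = tailCoupling θ u v`, `k₀ = Re 𝔅_θ(v)`, `n₁ = N₁(u)`, `n_θ = N_θ(v)`):
`[(k₀ + 2C·n_θ²)·a < (|c₀| − C·n₁n_θ)² ∧ C·n₁n_θ ≤ |c₀|] ∨ [k₀ + 2C·n_θ² < 0]`, and
`exists_neg_of_robustMargin`: a design with `RobustMargin θ C` CLOSES (`∃ s, q_X(s) < 0`) against EVERY `X` obeying
the two `C`-bounds at that design — the evaluable ROBUST criterion; `robustMargin_mono`: monotone in `C`, so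
**`C*(d) := sup {C ≥ 0 : RobustMargin θ C d}`** (the cell's currency `Cstar_offdiag`, OBJECTIVE.md §4.2) is certified
by bisection on `RobustMargin` from the five atoms; closed form for the record (elementary, not used by the kernel):
with `m₀ = n₁n_θ`, `C*(d) = max(C_k, min(C₁, |c₀|/m₀))` where `C_k = −k₀/(2n_θ²)` if `k₀ < 0` else `0`, and `C₁` =
the smaller root of `m₀²C² − 2(|c₀|m₀ + n_θ²a)C + (|c₀|² − k₀a) = 0` if `|c₀|² > k₀a` else `0`
(degenerate atoms `m₀ = 0` / `n_θ = 0` read as the obvious limits). Row E-002 for a design `d` then READS: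
«the true `X` is an off-diagonal form, `C`-bounded on the design's class with `C < C*(d)`».

**Part 4 (proved) — non-vacuity, and E-003's `X` as a CONCRETE functional.** `invisibleForm θ :=
M_θ ∘ (cut at the wall) − M_θ` (`cutLe g = g·𝟙_{y ≤ 1}`, `cutLt g′ = g′·𝟙_{y < 1}`, `M_θ = Repair.MformTop θ`):
`offDiagForm_invisibleForm : OffDiagForm θ (invisibleForm θ)` (every `θ`) and
`invisibleOverhang_invisibleForm : 1 ≤ θ → InvisibleOverhang θ (invisibleForm θ)` (via `rankOneTailCoupling_holds`),
hence `null_of_invisible`: in the `invisibleForm`-world no smooth two-piece design closes (the decided region R⁺,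
registry E-003 = `KnifeEdgeDiscMeanFlat` / `KnifeEdgeInvisibleTail`). For the NON-smooth classes (O1) the true `X`
stays the open object E-002 and designs are priced through Parts 1 + 3.

**Part 5 — registry row E-002 `E*-len⁺(X)` typed (bare `Prop`s, OPEN IN PRINT — nearest result
[BuiPrattRoblesZaharescu2020, Theorem 1.1] = `buiPrattRoblesZaharescu2020_theorem11` gives the twisted second moment
to ONE prime modulus `q` with an arbitrary mollifier of length `q^κ`, `κ < 1/2 + 1/202` — far short of Zhang's
`Ψ`-family at length `P^θ = (pD)^{θ(1−o(1))}`, `θ > 1`).** `EStarLenPlusShape c' θ X 𝒱` (the `EStarLen` shape of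
`KnifeEdgeEStarLen` with the two-piece constant `twoPieceMainTerm θ X u u′ v v′ s` as main term, for designs
`s·u ⊕ v`, `v ∈ 𝒱`), `ClosesByPositivityIn θ X 𝒱`, and the proved endgame `theorem1_of_eStarLenPlusShape`
(positivity alone, via `eventually_not_assumptionA_of_negative_mainTerm`) — these three verbatim from the seat kit
`LenTypingKit.lean` of ls-knife-typer-1 (cell landau-siegel §D), adopted here as the vocabulary of record; the
priced form `EStarLenPlusBounded c' θ C 𝒱 := ∃ X, OffDiagForm θ X ∧ OffDiagBoundedOn θ C X 𝒱 ∧ EStarLenPlusShape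
c' θ X 𝒱` («the true off-diagonal main term of the class is a `C`-bounded off-diagonal form») and
`theorem1_of_eStarLenPlusBounded`: that + ONE design of the class with `RobustMargin θ C` + Prop. 2.2 (i) + Lemma 2.3
⇒ Theorem 1 of the manuscript. Conventions: E-001's `O` (`KnifeEdgeEStarLen.EStarLen`) enters a whole profile as
`Re O(g,g)`; the two-piece `X` enters as cross `X(u,v)` and diagonal `2Re X(v,v)` (`twoPieceMainTerm`).

**Part 6 (proved) — the dual currency `Creq_offdiag` (required strength) in kernel form.** `StrengthBelowReq θ C d`:
`2C·n_θ² ≤ k₀ ∧ (|c₀| + C·n₁n_θ)² ≤ (k₀ − 2C·n_θ²)·a` — then NO input obeying the two `C`-bounds at `d` makes `d`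
close (`twoPieceMainTerm_nonneg_of_strengthBelowReq`, `not_closes_of_strengthBelowReq`); antitone in `C`
(`strengthBelowReq_mono`), so **`Creq_offdiag(d) := sup {C ≥ 0 : StrengthBelowReq θ C d}`** is certified by bisection
(`> 0` exactly when `d` does not close at `X = 0`, `strengthBelowReq_zero_iff`; closed form: the positive root of
`m₀²C² + 2(|c₀|m₀ + n_θ²a)C + (|c₀|² − k₀a) = 0`, capped by `k₀/(2n_θ²)`); `not_robustMargin_of_strengthBelowReq`:
the two currencies are disjoint. This is the per-design price of the KILL wording «no design of the family closes
without an E*-len-strength input».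

References: Zhang, arXiv:2211.02515v1, §2 p. 6, Lemma 2.3, Prop. 2.2 (i); §7 Prop 7.1, (7.2) p.44; §8 (8.11)–(8.12),
(8.23) [cite: Zhang2022LandauSiegel, §7 Prop 7.1 (7.2), §8]; nearest printed technology H. M. Bui, K. Pratt,
N. Robles, A. Zaharescu (2020) [BuiPrattRoblesZaharescu2020, Theorem 1.1].
«The programme SEARCHES and TYPES; no claim about Landau–Siegel zeros, Theorems 1–2 of arXiv:2211.02515 or a
repaired Margin232 until a kernel theorem says so.»
-/

noncomputable section

open Complex Real ComplexConjugate Set intervalIntegral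
open _root_.MeasureTheory

namespace Literature.NumberTheory.LFunctions.Zhang2022

namespace KnifeEdge

open Repair Skeleton

/-! ### Part 0 — the real quadratic `a|s|² + 2Re(s·c) + k` over `s ∈ ℂ` (elementary; the closing criteria) -/

section Quadratic

variable {a k : ℝ} {c : ℂ}

/-- the test amplitude `s = −t·c̄`: `Re(s·c) = −t|c|²`, `|s|² = t²|c|²`. [folklore] -/
private theorem probe_re (t : ℝ) (c : ℂ) : ((-(t : ℂ) * conj c) * c).re = -(t * ‖c‖ ^ 2) := by
  have : (-(t : ℂ) * conj c) * c = -((t : ℂ) * (conj c * c)) := by ring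
  rw [this, Complex.conj_mul' c]
  simp [← Complex.ofReal_pow, ← Complex.ofReal_mul]

/-- `|−t·c̄|² = t²|c|²`. [folklore] -/
private theorem probe_norm_sq (t : ℝ) (c : ℂ) : ‖-(t : ℂ) * conj c‖ ^ 2 = t ^ 2 * ‖c‖ ^ 2 := by
  rw [norm_mul, norm_neg, Complex.norm_real, Complex.norm_conj, mul_pow, Real.norm_eq_abs, sq_abs]

/-- `a > 0`, `k·a < |c|²` ⇒ the quadratic is negative at `s = −c̄/a` (value `k − |c|²/a`). [folklore] -/
private theorem quadratic_exists_neg_of_pos (ha : 0 < a) (h : k * a < ‖c‖ ^ 2) :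
    ∃ s : ℂ, a * ‖s‖ ^ 2 + 2 * (s * c).re + k < 0 := by
  refine ⟨-((1 / a : ℝ) : ℂ) * conj c, ?_⟩
  rw [probe_re, probe_norm_sq]
  have e : a * ((1 / a) ^ 2 * ‖c‖ ^ 2) + 2 * -(1 / a * ‖c‖ ^ 2) + k = (k * a - ‖c‖ ^ 2) / a := by
    field_simp
    ring
  rw [e]
  exact div_neg_of_neg_of_pos (by linarith) ha

/-- `a > 0`, `|c|² ≤ k·a` ⇒ the quadratic is `≥ 0` everywhere (`a·q(s) = |as + c̄|² + (ka − |c|²)`). [folklore] -/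
private theorem quadratic_nonneg_of_pos (ha : 0 < a) (h : ‖c‖ ^ 2 ≤ k * a) (s : ℂ) :
    0 ≤ a * ‖s‖ ^ 2 + 2 * (s * c).re + k := by
  have hr : |(s * c).re| ≤ ‖s‖ * ‖c‖ := (Complex.abs_re_le_norm _).trans (norm_mul _ _).le
  have hr' := (abs_le.mp hr).1
  have hs := norm_nonneg s
  have hc := norm_nonneg c
  -- `a · q(s) ≥ (a‖s‖ − ‖c‖)² + (k a − ‖c‖²) ≥ 0`
  have key : 0 ≤ a * (a * ‖s‖ ^ 2 + 2 * (s * c).re + k) := by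
    nlinarith [sq_nonneg (a * ‖s‖ - ‖c‖), mul_nonneg ha.le (by linarith : 0 ≤ ‖s‖ * ‖c‖ + (s * c).re)]
  exact (mul_nonneg_iff_of_pos_left ha).mp key

/-- **`a > 0`: the design closes iff `k·a < |c|²`** (`ρ = |c|²/(a·k) > 1` when `k > 0`). [folklore] -/
private theorem quadratic_exists_neg_iff_of_pos (ha : 0 < a) :
    (∃ s : ℂ, a * ‖s‖ ^ 2 + 2 * (s * c).re + k < 0) ↔ k * a < ‖c‖ ^ 2 := by
  refine ⟨fun ⟨s, hs⟩ => ?_, quadratic_exists_neg_of_pos ha⟩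
  by_contra h
  exact absurd hs (not_lt.2 (quadratic_nonneg_of_pos ha (not_lt.1 h) s))

/-- `a = 0`, `c ≠ 0` ⇒ the (now affine) form is negative somewhere. [folklore] -/
private theorem quadratic_exists_neg_of_zero (ha : a = 0) (hc : c ≠ 0) :
    ∃ s : ℂ, a * ‖s‖ ^ 2 + 2 * (s * c).re + k < 0 := by
  have hcc : 0 < ‖c‖ ^ 2 := by positivity
  refine ⟨-(((|k| + 1) / (2 * ‖c‖ ^ 2) : ℝ) : ℂ) * conj c, ?_⟩
  rw [probe_re, ha, zero_mul, zero_add]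
  have e : 2 * -((|k| + 1) / (2 * ‖c‖ ^ 2) * ‖c‖ ^ 2) + k = k - (|k| + 1) := by
    field_simp
    ring
  rw [e]
  linarith [le_abs_self k]

/-- **`a = 0`: the design closes iff `c ≠ 0 ∨ k < 0`.** [folklore] -/
private theorem quadratic_exists_neg_iff_of_zero (ha : a = 0) :
    (∃ s : ℂ, a * ‖s‖ ^ 2 + 2 * (s * c).re + k < 0) ↔ c ≠ 0 ∨ k < 0 := by
  refine ⟨fun ⟨s, hs⟩ => ?_, fun h => ?_⟩
  · by_contra h
    push Not at h
    rw [ha, h.1] at hs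
    simp at hs
    linarith [h.2]
  · rcases h with h | h
    · exact quadratic_exists_neg_of_zero ha h
    · exact ⟨0, by simp [ha, h]⟩

/-- `k < 0` ⇒ the form is negative at `s = 0`. [folklore] -/
private theorem quadratic_neg_at_zero (hk : k < 0) : a * ‖(0:ℂ)‖ ^ 2 + 2 * ((0:ℂ) * c).re + k < 0 := by
  simp [hk]

/-- **`a ≥ 0` (the in-class case): complete closing criterion.** [folklore] -/
private theorem quadratic_exists_neg_iff_of_nonneg (ha : 0 ≤ a) :
    (∃ s : ℂ, a * ‖s‖ ^ 2 + 2 * (s * c).re + k < 0) ↔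
      (0 < a ∧ k * a < ‖c‖ ^ 2) ∨ (a = 0 ∧ (c ≠ 0 ∨ k < 0)) := by
  rcases ha.lt_or_eq with h | h
  · rw [quadratic_exists_neg_iff_of_pos h]
    constructor
    · exact fun hh => Or.inl ⟨h, hh⟩
    · rintro (⟨_, hh⟩ | ⟨h0, _⟩)
      · exact hh
      · exact absurd h0.symm h.ne
  · rw [quadratic_exists_neg_iff_of_zero h.symm]
    constructor
    · exact fun hh => Or.inr ⟨h.symm, hh⟩
    · rintro (⟨hh, _⟩ | ⟨_, hh⟩)
      · exact absurd h hh.ne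
      · exact hh

end Quadratic

/-! ### Part 1 — scalar coordinates of a two-piece design and the closing criteria for `twoPieceMainTerm` -/

section Coordinates

variable {θ : ℝ} {X : PairFunctional} {u u' v v' : ℝ → ℂ}

/-- The rank-one tail coupling `c₀ = π·conj(Φ_v)·L(u)` of an in-class piece with an overhang piece — the cross
coefficient of the continued calculus (`rankOneTailCoupling_holds`: `M_θ(u,v) = c₀`, `M_θ(v,u) = 0`).
[cite: Zhang2022LandauSiegel, Prop 7.1 p.44, (8.11)–(8.12)] -/
def tailCoupling (θ : ℝ) (u v : ℝ → ℂ) : ℂ := (π : ℂ) * conj (overhangMass θ v) * tailFunctional u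

/-- **The cross coefficient** `c = c₀ + X(u,v)` of the design in the `X`-world. [cite: Zhang2022LandauSiegel, §7 (7.2) p.44] -/
def crossCoeff (θ : ℝ) (X : PairFunctional) (u u' v v' : ℝ → ℂ) : ℂ := tailCoupling θ u v + X u u' v v'

/-- **The overhang constant** `k = Re 𝔅_θ(v) + 2Re X(v,v)` of the design in the `X`-world
(`k₀ = Re 𝔅_θ(v) = (Repair.topDiagForm θ v v′).re` at `X = 0`). [cite: Zhang2022LandauSiegel, §7 (7.2) p.44] -/
def overhangConst (θ : ℝ) (X : PairFunctional) (v v' : ℝ → ℂ) : ℝ := (topDiagForm θ v v').re + 2 * (X v v' v v').re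

/-- `q_X(s) = |s|²𝔅(u) + 2Re(s·c) + k`. [cite: Zhang2022LandauSiegel, §7 (7.2) p.44] -/
theorem twoPieceMainTerm_eq (θ : ℝ) (X : PairFunctional) (u u' v v' : ℝ → ℂ) (s : ℂ) :
    twoPieceMainTerm θ X u u' v v' s
      = mainTermForm u u' * ‖s‖ ^ 2 + 2 * (s * crossCoeff θ X u u' v v').re + overhangConst θ X v v' := by
  unfold twoPieceMainTerm crossCoeff overhangConst tailCoupling
  ring

/-- at `X = 0` the coordinates are the atoms `c₀`, `k₀`. [cite: Zhang2022LandauSiegel, §7 (7.2) p.44] -/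
theorem crossCoeff_zero : crossCoeff θ 0 u u' v v' = tailCoupling θ u v := by simp [crossCoeff]

/-- at `X = 0` the overhang constant is `k₀ = Re 𝔅_θ(v)`. [cite: Zhang2022LandauSiegel, §7 (7.2) p.44] -/
theorem overhangConst_zero : overhangConst θ 0 v v' = (topDiagForm θ v v').re := by simp [overhangConst]

/-- **CLOSING CRITERION (complete), in class (`𝔅(u) ≥ 0`):** the design `u ⊕ v` closes by positivity in the
`X`-world for some amplitude `s` iff `[𝔅(u) > 0 ∧ k·𝔅(u) < |c|²] ∨ [𝔅(u) = 0 ∧ (c ≠ 0 ∨ k < 0)]`.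
[cite: Zhang2022LandauSiegel, §7 Prop 7.1 (7.2) p.44] -/
theorem closes_iff (hu : InClassPiece u u') :
    (∃ s : ℂ, twoPieceMainTerm θ X u u' v v' s < 0) ↔
      (0 < mainTermForm u u' ∧ overhangConst θ X v v' * mainTermForm u u' < ‖crossCoeff θ X u u' v v'‖ ^ 2)
      ∨ (mainTermForm u u' = 0 ∧ (crossCoeff θ X u u' v v' ≠ 0 ∨ overhangConst θ X v v' < 0)) := by
  simp_rw [twoPieceMainTerm_eq]
  exact quadratic_exists_neg_iff_of_nonneg (mainTermForm_nonneg_of_isH1 hu.kinked.isH1)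

/-- **X-pricing row, `𝔅(u) > 0`:** closes iff `k·𝔅(u) < |c|²` (no class hypothesis needed).
[cite: Zhang2022LandauSiegel, §7 Prop 7.1 (7.2) p.44] -/
theorem closes_iff_of_pos (ha : 0 < mainTermForm u u') :
    (∃ s : ℂ, twoPieceMainTerm θ X u u' v v' s < 0) ↔
      overhangConst θ X v v' * mainTermForm u u' < ‖crossCoeff θ X u u' v v'‖ ^ 2 := by
  simp_rw [twoPieceMainTerm_eq]
  exact quadratic_exists_neg_iff_of_pos ha

/-- **X-pricing row, kernel mode `𝔅(u) = 0`:** closes iff `c ≠ 0 ∨ k < 0` (cf. `kernelModeCancellation_of_null`).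
[cite: Zhang2022LandauSiegel, §7 Prop 7.1 (7.2) p.44] -/
theorem closes_iff_of_zero (ha : mainTermForm u u' = 0) :
    (∃ s : ℂ, twoPieceMainTerm θ X u u' v v' s < 0) ↔
      crossCoeff θ X u u' v v' ≠ 0 ∨ overhangConst θ X v v' < 0 := by
  simp_rw [twoPieceMainTerm_eq]
  exact quadratic_exists_neg_iff_of_zero ha

/-- **X-pricing row, negative overhang constant:** `k < 0` closes at `s = 0` (pure overhang design).
[cite: Zhang2022LandauSiegel, §7 Prop 7.1 (7.2) p.44] -/
theorem closes_of_overhangConst_neg (hk : overhangConst θ X v v' < 0) :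
    twoPieceMainTerm θ X u u' v v' 0 < 0 := by
  rw [twoPieceMainTerm_eq]; simp [hk]

end Coordinates

/-! ### Part 2 — definition request D-len-1: the axioms of an off-diagonal form (a `Prop`-valued structure) -/

/-- **OFF-DIAGONAL FORM (D-len-1): the axioms a derivation of the off-diagonal main term `X` of the classes
`n ≡ m (mod p)`, `n ≠ m`, would deliver, as used by the two-piece bookkeeping `twoPieceMainTerm`.**
* `below_wall` — NO off-diagonal MAIN term between two in-class pieces (lengths `≤ P`): this encodes (7.2) +
  Prop 7.1 («the classes `n ≡ m (mod p)`, `n ≠ m`, contribute `O(P/T²)`-negligibly for `n, m ≤ P`») as an AXIOM ON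
  THE CANDIDATE `X`. For the audited class R it is a THEOREM of the tree (the p428635 chain behind
  `Repair.not_repairable_true_need`: inside R every main-order constant is a value of the PSD form `𝔅`), and in the
  continued calculus an in-class piece meets an overhang only through `KnifeEdge.rankOneTailCoupling_holds`; for
  candidates outside R (the region R⁺ ∖ R of the cell's OBJECTIVE.md §1.3) NOTHING in the tree or in print asserts
  it — no reader should take this structure for a claim about the true dictionary there.
* `smul_left` / `smul_right` — homogeneous in the first piece, conjugate-homogeneous in the second (the shape of
  `Repair.MformTop θ`; `MformTop_smul_left` / `MformTop_smul_right` below).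
NO Hermitian / reality field: `twoPieceMainTerm` reads `X` only at `(u,v)` (cross) and `(v,v)` (diagonal); the
`(v,u)` slot is silent, as `M_θ(v,u) = 0` is. NO additivity field (needed only for `k ≥ 3`-piece `X`-designs; to be a
second predicate, append-only). NO existence: the construction of the true `X` is registry row E-002.
Inhabited by `invisibleForm θ` (`offDiagForm_invisibleForm`) and by `0` (`offDiagForm_zero`).
[cite: Zhang2022LandauSiegel, §7 Prop 7.1, (7.2) p.44] -/
structure OffDiagForm (θ : ℝ) (X : PairFunctional) : Prop where
  below_wall : ∀ u u' w w' : ℝ → ℂ, InClassPiece u u' → InClassPiece w w' → X u u' w w' = 0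
  smul_left : ∀ (c : ℂ) (a a' b b' : ℝ → ℂ), X (c • a) (c • a') b b' = c * X a a' b b'
  smul_right : ∀ (c : ℂ) (a a' b b' : ℝ → ℂ), X a a' (c • b) (c • b') = conj c * X a a' b b'

/-- the continued calculus `X = 0` is (trivially) an off-diagonal form; `θ` is a bookkeeping index only.
[cite: Zhang2022LandauSiegel, §7 (7.2) p.44] -/
theorem offDiagForm_zero (θ : ℝ) : OffDiagForm θ 0 where
  below_wall := fun _ _ _ _ _ _ => rfl
  smul_left := fun _ _ _ _ _ => by simp
  smul_right := fun _ _ _ _ _ => by simp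

/-! ### Part 3 — `C`-boundedness and the ROBUST closing criterion (proved); the currency `C*(d)` -/

section Robust

/-- `N₁(u) = (∫₀¹ |u|² + |u′|²)^{1/2}`, the `H¹`-size of an in-class piece (the norm `𝔅` is continuous in:
`MainTermFormCauchySchwarz`). [folklore] -/
def inClassNorm (u u' : ℝ → ℂ) : ℝ := Real.sqrt (∫ t in (0:ℝ)..1, (‖u t‖ ^ 2 + ‖u' t‖ ^ 2))

/-- `N_θ(v) = (∫₁^θ |v|² + |v′|²)^{1/2}`, the `H¹`-size of an overhang piece of length `θ`. [folklore] -/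
def overhangNorm (θ : ℝ) (v v' : ℝ → ℂ) : ℝ := Real.sqrt (∫ t in (1:ℝ)..θ, (‖v t‖ ^ 2 + ‖v' t‖ ^ 2))

/-- `N₁(u) ≥ 0`. [cite: Zhang2022LandauSiegel, §7 (7.2) p.44] -/
theorem inClassNorm_nonneg (u u' : ℝ → ℂ) : 0 ≤ inClassNorm u u' := Real.sqrt_nonneg _

/-- `N_θ(v) ≥ 0`. [cite: Zhang2022LandauSiegel, §7 (7.2) p.44] -/
theorem overhangNorm_nonneg (θ : ℝ) (v v' : ℝ → ℂ) : 0 ≤ overhangNorm θ v v' := Real.sqrt_nonneg _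

/-- **`C`-BOUNDED off-diagonal input on a design class** (`u` in class, `v ∈ 𝒱`): `|X(u,v)| ≤ C·N₁(u)·N_θ(v)` and
`|Re X(v,v)| ≤ C·N_θ(v)²` — the quantitative companion of `OffDiagForm` through which a design is PRICED: it
closes against EVERY such `X` as soon as `RobustMargin θ C` holds (`exists_neg_of_robustMargin`). Bare predicate,
asserted for no `X`. [cite: Zhang2022LandauSiegel, §7 (7.2) p.44] -/
def OffDiagBoundedOn (θ C : ℝ) (X : PairFunctional) (𝒱 : (ℝ → ℂ) → (ℝ → ℂ) → Prop) : Prop :=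
  ∀ u u' v v' : ℝ → ℂ, InClassPiece u u' → 𝒱 v v' →
    ‖X u u' v v'‖ ≤ C * inClassNorm u u' * overhangNorm θ v v'
    ∧ |(X v v' v v').re| ≤ C * overhangNorm θ v v' ^ 2

/-- `C`-bounded on the smooth top-vanishing overhang class of `KnifeEdgeOverhangRankOne`.
[cite: Zhang2022LandauSiegel, §7 (7.2) p.44] -/
abbrev OffDiagBounded (θ C : ℝ) (X : PairFunctional) : Prop := OffDiagBoundedOn θ C X (OverhangPiece θ)

/-- the continued calculus `X = 0` is `C`-bounded for every `C ≥ 0`. [cite: Zhang2022LandauSiegel, §7 (7.2) p.44] -/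
theorem offDiagBoundedOn_zero {θ C : ℝ} (hC : 0 ≤ C) (𝒱 : (ℝ → ℂ) → (ℝ → ℂ) → Prop) :
    OffDiagBoundedOn θ C 0 𝒱 := by
  intro u u' v v' _ _
  refine ⟨?_, ?_⟩
  · simpa using mul_nonneg (mul_nonneg hC (inClassNorm_nonneg u u')) (overhangNorm_nonneg θ v v')
  · simpa using mul_nonneg hC (sq_nonneg (overhangNorm θ v v'))

/-- `C`-boundedness is monotone in `C`. [cite: Zhang2022LandauSiegel, §7 (7.2) p.44] -/
theorem OffDiagBoundedOn.mono {θ C C' : ℝ} {X : PairFunctional} {𝒱 : (ℝ → ℂ) → (ℝ → ℂ) → Prop}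
    (h : OffDiagBoundedOn θ C X 𝒱) (hle : C ≤ C') : OffDiagBoundedOn θ C' X 𝒱 := by
  intro u u' v v' hu hv
  obtain ⟨h1, h2⟩ := h u u' v v' hu hv
  have hn := mul_nonneg (inClassNorm_nonneg u u') (overhangNorm_nonneg θ v v')
  refine ⟨h1.trans ?_, h2.trans ?_⟩
  · rw [mul_assoc, mul_assoc]; exact mul_le_mul_of_nonneg_right hle hn
  · exact mul_le_mul_of_nonneg_right hle (sq_nonneg _)

variable {θ C : ℝ} {X : PairFunctional} {u u' v v' : ℝ → ℂ}

/-- **THE ROBUST MARGIN of a design at level `C`** — an ELEMENTARY inequality in the five certified atoms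
`a = 𝔅(u) = mainTermForm u u′`, `c₀ = tailCoupling θ u v`, `k₀ = (topDiagForm θ v v′).re`, `n₁ = inClassNorm u u′`,
`n_θ = overhangNorm θ v v′`:  `[(k₀ + 2C·n_θ²)·a < (|c₀| − C·n₁n_θ)² ∧ C·n₁n_θ ≤ |c₀|] ∨ [k₀ + 2C·n_θ² < 0]`.
The cell's currency `Cstar_offdiag` is `C*(d) := sup {C ≥ 0 : RobustMargin θ C d}` (monotone: `robustMargin_mono`;
certify by bisection; closed form in the module docstring). At `C = 0` it is the `X = 0` closing criterion minus the
degenerate corner `a = 0 ∧ c₀ = 0 ∧ k₀ ≥ 0` (`robustMargin_zero_iff`). [cite: Zhang2022LandauSiegel, §7 (7.2) p.44] -/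
def RobustMargin (θ C : ℝ) (u u' v v' : ℝ → ℂ) : Prop :=
  (((topDiagForm θ v v').re + 2 * C * overhangNorm θ v v' ^ 2) * mainTermForm u u'
        < (‖tailCoupling θ u v‖ - C * inClassNorm u u' * overhangNorm θ v v') ^ 2
      ∧ C * inClassNorm u u' * overhangNorm θ v v' ≤ ‖tailCoupling θ u v‖)
    ∨ (topDiagForm θ v v').re + 2 * C * overhangNorm θ v v' ^ 2 < 0

/-- **ROBUST CLOSING (pointwise form).** If `𝔅(u) ≥ 0`, the two `C`-bounds hold AT THIS DESIGN, and
`RobustMargin θ C` holds, then the design closes by positivity in the `X`-world: `∃ s, q_X(s) < 0`.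
Mechanism: `|c| ≥ |c₀| − |X(u,v)| ≥ |c₀| − C·n₁n_θ ≥ 0` and `k ≤ k₀ + 2C·n_θ²`, then Part 0.
[cite: Zhang2022LandauSiegel, §7 Prop 7.1 (7.2) p.44] -/
theorem exists_neg_of_robustMargin (ha : 0 ≤ mainTermForm u u')
    (hx : ‖X u u' v v'‖ ≤ C * inClassNorm u u' * overhangNorm θ v v')
    (hy : |(X v v' v v').re| ≤ C * overhangNorm θ v v' ^ 2) (hm : RobustMargin θ C u u' v v') :
    ∃ s : ℂ, twoPieceMainTerm θ X u u' v v' s < 0 := by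
  simp_rw [twoPieceMainTerm_eq]
  set a := mainTermForm u u' with ha_def
  set c := crossCoeff θ X u u' v v' with hc_def
  set k := overhangConst θ X v v' with hk_def
  set c₀ := tailCoupling θ u v with hc₀
  set m := C * inClassNorm u u' * overhangNorm θ v v' with hm_def
  set K := (topDiagForm θ v v').re + 2 * C * overhangNorm θ v v' ^ 2 with hK
  -- `k ≤ K`
  have hkK : k ≤ K := by
    have := (abs_le.mp hy).2
    simp only [hk_def, overhangConst, hK]
    linarith
  -- `‖c‖ ≥ ‖c₀‖ − m`
  have hcm : ‖c₀‖ - m ≤ ‖c‖ := by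
    have h1 : ‖c₀‖ ≤ ‖c₀ + X u u' v v'‖ + ‖X u u' v v'‖ := by
      calc ‖c₀‖ = ‖(c₀ + X u u' v v') - X u u' v v'‖ := by ring_nf
        _ ≤ ‖c₀ + X u u' v v'‖ + ‖X u u' v v'‖ := norm_sub_le _ _
    have h2 : c = c₀ + X u u' v v' := rfl
    rw [h2]
    linarith
  rcases hm with ⟨hlt, hle⟩ | hneg
  · -- branch 1: `K·a < (‖c₀‖ − m)²`, `m ≤ ‖c₀‖`
    have hsq : (‖c₀‖ - m) ^ 2 ≤ ‖c‖ ^ 2 := pow_le_pow_left₀ (by linarith) hcm 2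
    rcases ha.lt_or_eq with hpos | hzero
    · refine quadratic_exists_neg_of_pos hpos ?_
      calc k * a ≤ K * a := mul_le_mul_of_nonneg_right hkK ha
        _ < (‖c₀‖ - m) ^ 2 := hlt
        _ ≤ ‖c‖ ^ 2 := hsq
    · refine quadratic_exists_neg_of_zero hzero.symm ?_
      have : 0 < ‖c‖ ^ 2 := by
        calc (0:ℝ) = K * a := by rw [← hzero, mul_zero]
          _ < (‖c₀‖ - m) ^ 2 := hlt
          _ ≤ ‖c‖ ^ 2 := hsq
      intro h0
      rw [h0, norm_zero] at this
      norm_num at this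
  · -- branch 2: `k ≤ K < 0`, close at `s = 0`
    exact ⟨0, by simp; linarith⟩

/-- **ROBUST CLOSING (class form): a design of the class with `RobustMargin θ C` closes against EVERY off-diagonal
input that is `C`-bounded on the class** — the priced reading of row E-002 («the true `X` is `C`-bounded with
`C < C*(d)`»). [cite: Zhang2022LandauSiegel, §7 Prop 7.1 (7.2) p.44] -/
theorem exists_neg_of_offDiagBoundedOn {𝒱 : (ℝ → ℂ) → (ℝ → ℂ) → Prop} (hB : OffDiagBoundedOn θ C X 𝒱)
    (hu : InClassPiece u u') (hv : 𝒱 v v') (hm : RobustMargin θ C u u' v v') :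
    ∃ s : ℂ, twoPieceMainTerm θ X u u' v v' s < 0 :=
  exists_neg_of_robustMargin (mainTermForm_nonneg_of_isH1 hu.kinked.isH1) (hB u u' v v' hu hv).1
    (hB u u' v v' hu hv).2 hm

/-- … in particular on the smooth class: `ClosesByPositivity θ X`. [cite: Zhang2022LandauSiegel, §7 Prop 7.1 (7.2) p.44] -/
theorem closesByPositivity_of_robustMargin (hB : OffDiagBounded θ C X) (hu : InClassPiece u u')
    (hv : OverhangPiece θ v v') (hm : RobustMargin θ C u u' v v') : ClosesByPositivity θ X := by
  obtain ⟨s, hs⟩ := exists_neg_of_offDiagBoundedOn hB hu hv hm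
  exact ⟨u, u', v, v', s, hu, hv, hs⟩

/-- **`RobustMargin` is monotone in `C`** (for `𝔅(u) ≥ 0`): the admissible levels form an initial segment of
`[0, ∞)`, so `C*(d)` is certified by bisection. [cite: Zhang2022LandauSiegel, §7 (7.2) p.44] -/
theorem robustMargin_mono (ha : 0 ≤ mainTermForm u u') {C C' : ℝ} (hle : C' ≤ C)
    (h : RobustMargin θ C u u' v v') : RobustMargin θ C' u u' v v' := by
  have hn1 := inClassNorm_nonneg u u'
  have hn2 := overhangNorm_nonneg θ v v'
  have hm : C' * inClassNorm u u' * overhangNorm θ v v' ≤ C * inClassNorm u u' * overhangNorm θ v v' := by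
    rw [mul_assoc, mul_assoc]; exact mul_le_mul_of_nonneg_right hle (mul_nonneg hn1 hn2)
  have hK : (topDiagForm θ v v').re + 2 * C' * overhangNorm θ v v' ^ 2
      ≤ (topDiagForm θ v v').re + 2 * C * overhangNorm θ v v' ^ 2 := by
    nlinarith [sq_nonneg (overhangNorm θ v v')]
  rcases h with ⟨hlt, hle'⟩ | hneg
  · left
    refine ⟨?_, hm.trans hle'⟩
    have hsq : (‖tailCoupling θ u v‖ - C * inClassNorm u u' * overhangNorm θ v v') ^ 2
        ≤ (‖tailCoupling θ u v‖ - C' * inClassNorm u u' * overhangNorm θ v v') ^ 2 :=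
      pow_le_pow_left₀ (by linarith) (by linarith) 2
    calc ((topDiagForm θ v v').re + 2 * C' * overhangNorm θ v v' ^ 2) * mainTermForm u u'
        ≤ ((topDiagForm θ v v').re + 2 * C * overhangNorm θ v v' ^ 2) * mainTermForm u u' :=
          mul_le_mul_of_nonneg_right hK ha
      _ < _ := hlt
      _ ≤ _ := hsq
  · right; linarith

/-- at level `C = 0` the robust margin is the `X = 0` closing criterion of Part 1 without its degenerate corner:
`[k₀·a < |c₀|²] ∨ [k₀ < 0]`. [cite: Zhang2022LandauSiegel, §7 (7.2) p.44] -/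
theorem robustMargin_zero_iff :
    RobustMargin θ 0 u u' v v' ↔
      (topDiagForm θ v v').re * mainTermForm u u' < ‖tailCoupling θ u v‖ ^ 2 ∨ (topDiagForm θ v v').re < 0 := by
  simp [RobustMargin]

end Robust

/-! ### Part 4 — the canonical inhabitant: `invisibleForm θ = M_θ ∘ (cut at the wall) − M_θ` (proved) -/

section InvisibleForm

/-- cut a profile at the wall: keep `y ≤ 1`, zero beyond. [cite: Zhang2022LandauSiegel, §7 (7.2) p.44] -/
def cutLe (g : ℝ → ℂ) : ℝ → ℂ := fun y => if y ≤ 1 then g y else 0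

/-- cut a marked derivative at the wall: keep `y < 1`, zero from the wall on. [cite: Zhang2022LandauSiegel, §7 (7.2) p.44] -/
def cutLt (g' : ℝ → ℂ) : ℝ → ℂ := fun y => if y < 1 then g' y else 0

/-- **THE INVISIBLE FORM**: `X_inv(a,b) = M_θ(cut a, cut b) − M_θ(a,b)` — the off-diagonal input under which
profile mass beyond the wall contributes NOTHING at main order (the `X`-world `M_θ + X_inv = M_θ ∘ cut`): E-003's
`X` as a concrete functional (for SMOOTH pieces beyond `P^{1+ε}` this is what complete character sums to modulus
`pD` deliver: `KnifeEdgeInvisibleTail`, `KnifeEdgeDiscMeanFlat`). [cite: Zhang2022LandauSiegel, §7 (7.2) p.44] -/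
def invisibleForm (θ : ℝ) : PairFunctional := fun a a' b b' =>
  MformTop θ (cutLe a) (cutLt a') (cutLe b) (cutLt b') - MformTop θ a a' b b'

variable {θ : ℝ} {u u' v v' : ℝ → ℂ}

/-- the cut commutes with scalars. [cite: Zhang2022LandauSiegel, §7 (7.2) p.44] -/
theorem cutLe_smul (c : ℂ) (g : ℝ → ℂ) : cutLe (c • g) = c • cutLe g := by
  funext y; by_cases hy : y ≤ 1 <;> simp [cutLe, hy]

/-- the derivative cut commutes with scalars. [cite: Zhang2022LandauSiegel, §7 (7.2) p.44] -/
theorem cutLt_smul (c : ℂ) (g : ℝ → ℂ) : cutLt (c • g) = c • cutLt g := by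
  funext y; by_cases hy : y < 1 <;> simp [cutLt, hy]

/-- an in-class piece is its own cut. [cite: Zhang2022LandauSiegel, §7 (7.2) p.44] -/
theorem cutLe_of_inClass (hu : InClassPiece u u') : cutLe u = u := by
  funext y
  by_cases hy : y ≤ 1
  · simp [cutLe, hy]
  · simp [cutLe, hy, hu.vanish y (le_of_not_ge hy)]

/-- the marked derivative of an in-class piece is its own cut. [cite: Zhang2022LandauSiegel, §7 (7.2) p.44] -/
theorem cutLt_of_inClass (hu : InClassPiece u u') : cutLt u' = u' := by
  funext y
  by_cases hy : y < 1
  · simp [cutLt, hy]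
  · simp [cutLt, hy, hu.vanish' y (le_of_not_gt hy)]

/-- an overhang piece is cut to zero. [cite: Zhang2022LandauSiegel, §7 (7.2) p.44] -/
theorem cutLe_of_overhang (hv : OverhangPiece θ v v') : cutLe v = 0 := by
  funext y
  by_cases hy : y ≤ 1
  · simp [cutLe, hy, hv.vanish y hy]
  · simp [cutLe, hy]

/-- the marked derivative of an overhang piece is cut to zero. [cite: Zhang2022LandauSiegel, §7 (7.2) p.44] -/
theorem cutLt_of_overhang (hv : OverhangPiece θ v v') : cutLt v' = 0 := by
  funext y
  by_cases hy : y < 1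
  · simp [cutLt, hy, hv.vanish' y hy]
  · simp [cutLt, hy]

/-- `M_T` is homogeneous in the first profile pair (no integrability needed). [cite: Zhang2022LandauSiegel, Prop 7.1, (8.11)–(8.12)] -/
theorem MformTop_smul_left (T : ℝ) (c : ℂ) (g g' h h' : ℝ → ℂ) :
    MformTop T (c • g) (c • g') h h' = c * MformTop T g g' h h' := by
  have hd : ∀ j : ℕ, (fun y => dipoleIntegrandTop T j (c • g) (c • g') h h' y)
      = fun y => c * dipoleIntegrandTop T j g g' h h' y := by
    intro j; funext y
    simp only [dipoleIntegrandTop, Pi.smul_apply, smul_eq_mul]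
    ring
  unfold MformTop
  rw [hd 1, hd 2, hd 3, intervalIntegral.integral_const_mul, intervalIntegral.integral_const_mul,
    intervalIntegral.integral_const_mul]
  ring

/-- `M_T` is conjugate-homogeneous in the second profile pair. [cite: Zhang2022LandauSiegel, Prop 7.1, (8.11)–(8.12)] -/
theorem MformTop_smul_right (T : ℝ) (c : ℂ) (g g' h h' : ℝ → ℂ) :
    MformTop T g g' (c • h) (c • h') = conj c * MformTop T g g' h h' := by
  have hd : ∀ j : ℕ, (fun y => dipoleIntegrandTop T j g g' (c • h) (c • h') y)
      = fun y => conj c * dipoleIntegrandTop T j g g' h h' y := by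
    intro j; funext y
    simp only [dipoleIntegrandTop, Pi.smul_apply, smul_eq_mul]
    rw [intervalIntegral.integral_const_mul]
    have : c * h' y + I * π * ((bS j : ℝ) : ℂ) * (c * h y) + (π : ℂ) ^ 2 * ((bN j : ℝ) : ℂ) * (c * ∫ t in y..T, h t)
        = c * (h' y + I * π * ((bS j : ℝ) : ℂ) * h y + (π : ℂ) ^ 2 * ((bN j : ℝ) : ℂ) * ∫ t in y..T, h t) := by
      ring
    rw [this, map_mul]
    ring
  unfold MformTop
  rw [hd 1, hd 2, hd 3, intervalIntegral.integral_const_mul, intervalIntegral.integral_const_mul,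
    intervalIntegral.integral_const_mul]
  ring

/-- `M_T(g, 0) = 0`. [cite: Zhang2022LandauSiegel, Prop 7.1, (8.11)–(8.12)] -/
theorem MformTop_zero_right (T : ℝ) (g g' : ℝ → ℂ) : MformTop T g g' 0 0 = 0 := by
  have := MformTop_smul_right T 0 g g' 0 0
  simpa using this

/-- `M_T(0, h) = 0`. [cite: Zhang2022LandauSiegel, Prop 7.1, (8.11)–(8.12)] -/
theorem MformTop_zero_left (T : ℝ) (h h' : ℝ → ℂ) : MformTop T 0 0 h h' = 0 := by
  have := MformTop_smul_left T 0 0 0 h h'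
  simpa using this

/-- **`invisibleForm θ` IS an off-diagonal form** (every `θ`): below the wall the cut is the identity, and `M_θ`
is (conjugate-)homogeneous. [cite: Zhang2022LandauSiegel, §7 Prop 7.1 (7.2) p.44] -/
theorem offDiagForm_invisibleForm (θ : ℝ) : OffDiagForm θ (invisibleForm θ) where
  below_wall := fun u u' w w' hu hw => by
    simp only [invisibleForm, cutLe_of_inClass hu, cutLt_of_inClass hu, cutLe_of_inClass hw, cutLt_of_inClass hw,
      sub_self]
  smul_left := fun c a a' b b' => by
    simp only [invisibleForm, cutLe_smul, cutLt_smul, MformTop_smul_left]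
    ring
  smul_right := fun c a a' b b' => by
    simp only [invisibleForm, cutLe_smul, cutLt_smul, MformTop_smul_right]
    ring

/-- on a smooth two-piece design the invisible form takes the values `X(u,v) = −M_θ(u,v)`, `X(v,v) = −M_θ(v,v)`.
[cite: Zhang2022LandauSiegel, §7 Prop 7.1 (7.2) p.44] -/
theorem invisibleForm_apply_inClass_overhang (hu : InClassPiece u u') (hv : OverhangPiece θ v v') :
    invisibleForm θ u u' v v' = -MformTop θ u u' v v'
    ∧ invisibleForm θ v v' v v' = -MformTop θ v v' v v' := by
  simp only [invisibleForm, cutLe_of_inClass hu, cutLt_of_inClass hu, cutLe_of_overhang hv, cutLt_of_overhang hv,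
    MformTop_zero_right, zero_sub, and_self]

/-- **`invisibleForm θ` realises `InvisibleOverhang θ`** for every `θ ≥ 1`: it cancels exactly the rank-one tail
coupling (`rankOneTailCoupling_holds`) and nets the overhang block to zero — so `null_of_invisible` /
`not_closes_of_invisible` apply: in this `X`-world no smooth two-piece design closes (region R⁺, decided).
[cite: Zhang2022LandauSiegel, §7 Prop 7.1 (7.2) p.44, (8.11)–(8.12)] -/
theorem invisibleOverhang_invisibleForm (hθ : 1 ≤ θ) : InvisibleOverhang θ (invisibleForm θ) := by
  intro u u' v v' hu hv
  obtain ⟨h1, h2⟩ := invisibleForm_apply_inClass_overhang hu hv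
  obtain ⟨hc, _⟩ := rankOneTailCoupling_holds hθ u u' v v' hu hv
  refine ⟨by rw [h1, hc], ?_⟩
  rw [h2, topDiagForm_re, Complex.neg_re]
  ring

/-- … hence the smooth two-piece null in the `invisibleForm`-world. [cite: Zhang2022LandauSiegel, §7 Prop 7.1 (7.2) p.44] -/
theorem null_invisibleForm (hθ : 1 ≤ θ) : Null θ (invisibleForm θ) :=
  null_of_invisible (invisibleOverhang_invisibleForm hθ)

/-- … and no smooth two-piece design closes in the `invisibleForm`-world. [cite: Zhang2022LandauSiegel, §7 (7.2) p.44] -/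
theorem not_closes_invisibleForm (hθ : 1 ≤ θ) : ¬ ClosesByPositivity θ (invisibleForm θ) :=
  not_closes_of_invisible (invisibleOverhang_invisibleForm hθ)

/-- in the `invisibleForm`-world the coordinates of a smooth design are `c = 0`, `k = 0` (so `closes_iff` says:
never). [cite: Zhang2022LandauSiegel, §7 Prop 7.1 (7.2) p.44] -/
theorem crossCoeff_invisibleForm (hθ : 1 ≤ θ) (hu : InClassPiece u u') (hv : OverhangPiece θ v v') :
    crossCoeff θ (invisibleForm θ) u u' v v' = 0 ∧ overhangConst θ (invisibleForm θ) v v' = 0 := by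
  obtain ⟨h1, h2⟩ := invisibleOverhang_invisibleForm hθ u u' v v' hu hv
  refine ⟨?_, h2⟩
  rw [crossCoeff, tailCoupling, h1, add_neg_cancel]

end InvisibleForm

/-! ### Part 5 — registry row E-002 `E*-len⁺(X)`: the two-piece estimate shape, its priced (bounded) form, and the
POS endgames (statements OPEN IN PRINT; implications proved) -/

section EStarLenPlus

variable (c' : ℝ)

/-- **E*-len⁺(X) — statement SHAPE (OPEN IN PRINT — nearest result [BuiPrattRoblesZaharescu2020, Theorem 1.1] =
`buiPrattRoblesZaharescu2020_theorem11` gives the twisted second moment to ONE prime modulus `q` with an arbitrary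
mollifier of length `q^κ`, `κ < 1/2 + 1/202`; NOT asserted).** For a class `𝒱` of overhang pieces of length `θ` and
a NAMED off-diagonal pair functional `X`: for every two-piece design `s·u ⊕ v` (`u` in class, `v ∈ 𝒱`), under (A),
eventually in `D`, the discrete mean of the profile polynomial of length `⌈P^θ⌉` equals
`twoPieceMainTerm θ X u u′ v v′ s · 𝔞𝔓 + o(𝔞𝔓)` (the shape of `KnifeEdge.EStarLen` of `KnifeEdgeEStarLen` with the
two-piece constant in place of `Re(𝔅_{1+δ}(g) + O(g,g))`). A card instantiates `𝒱` (its non-smooth class) and `X`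
(its claimed off-diagonal main term); the lever is `ClosesByPositivity θ X` restricted to `𝒱`. Statement verbatim
from the §D seat kit `LenTypingKit.lean` (ls-knife-typer-1). [cite: Zhang2022LandauSiegel, §7 Prop 7.1 (7.2) p.44; §8 (8.23)] -/
def EStarLenPlusShape (θ : ℝ) (X : PairFunctional) (𝒱 : (ℝ → ℂ) → (ℝ → ℂ) → Prop) : Prop :=
  ∀ (u u' v v' : ℝ → ℂ) (s : ℂ), InClassPiece u u' → 𝒱 v v' →
    ∀ ε : ℝ, 0 < ε → ForAllLarge fun D _ χ => AssumptionA D χ →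
      |discMean c' χ (fun x t => profPoly χ x (fun z => s * u z + v z) ⌈bigP D ^ θ⌉₊ t)
          - twoPieceMainTerm θ X u u' v v' s * frakA χ * frakP D| ≤ ε * frakA χ * frakP D

/-- **The lever restricted to a class (shape, NOT asserted):** some design with overhang in `𝒱` has a NEGATIVE
two-piece main constant in the `X`-world (`𝒱 = OverhangPiece θ`: `ClosesByPositivity θ X`). Verbatim from the §D seat
kit. [cite: Zhang2022LandauSiegel, §7 Prop 7.1 (7.2) p.44] -/
def ClosesByPositivityIn (θ : ℝ) (X : PairFunctional) (𝒱 : (ℝ → ℂ) → (ℝ → ℂ) → Prop) : Prop :=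
  ∃ (u u' v v' : ℝ → ℂ) (s : ℂ), InClassPiece u u' ∧ 𝒱 v v' ∧ twoPieceMainTerm θ X u u' v v' s < 0

/-- **E*-len⁺ PRICED (row E-002 as read per design; OPEN IN PRINT, NOT asserted):** the true off-diagonal main term
of the class `𝒱` at length `θ` is SOME off-diagonal form (`OffDiagForm`: below-wall vanishing, homogeneity) that is
`C`-bounded on the class (`OffDiagBoundedOn`) and for which the two-piece asymptotic `EStarLenPlusShape` holds. The
existential over `X` is the honest content of E-002 («there is an off-diagonal main term of at most this size»), not
a construction; a design `d` with `C*(d) > C` turns it into `¬(A)` (`theorem1_of_eStarLenPlusBounded`).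
[cite: Zhang2022LandauSiegel, §7 Prop 7.1 (7.2) p.44; §8 (8.23)] -/
def EStarLenPlusBounded (θ C : ℝ) (𝒱 : (ℝ → ℂ) → (ℝ → ℂ) → Prop) : Prop :=
  ∃ X : PairFunctional, OffDiagForm θ X ∧ OffDiagBoundedOn θ C X 𝒱 ∧ EStarLenPlusShape c' θ X 𝒱

variable {c'} {θ C : ℝ} {X : PairFunctional} {𝒱 : (ℝ → ℂ) → (ℝ → ℂ) → Prop}

/-- on the smooth class the restricted lever is `ClosesByPositivity` of `KnifeEdgeOverhangRankOne`. [cite: Zhang2022LandauSiegel, §7 (7.2) p.44] -/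
theorem closesByPositivityIn_overhangPiece_iff :
    ClosesByPositivityIn θ X (OverhangPiece θ) ↔ ClosesByPositivity θ X := Iff.rfl

/-- **The POS endgame for a two-piece class (kernel implication, proved):** E*-len⁺ for the class `𝒱` in the
`X`-world + a design of the class with NEGATIVE two-piece constant + Zhang's Part-1 zero model (Prop. 2.2 (i),
Lemma 2.3) ⇒ Theorem 1 of the manuscript — by positivity alone, via
`KnifeEdge.eventually_not_assumptionA_of_negative_mainTerm`. Both `E*` hypotheses are OPEN; nothing asserted.
Verbatim from the §D seat kit. [cite: Zhang2022LandauSiegel, §2 p. 6, §7 Prop 7.1 (7.2)] -/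
theorem theorem1_of_eStarLenPlusShape (hE : EStarLenPlusShape c' θ X 𝒱) (hC : ClosesByPositivityIn θ X 𝒱)
    (h22 : Prop22i) (h23 : Lemma23 c') : Theorem1 := by
  obtain ⟨u, u', v, v', s, hu, hv, hneg⟩ := hC
  exact Skeleton.theorem1_of_eventually_not_assumptionA
    (eventually_not_assumptionA_of_negative_mainTerm hneg (hE u u' v v' s hu hv) h22 h23)

/-- … and Theorem 2. [cite: Zhang2022LandauSiegel, §1 Theorem 2] -/
theorem theorem2_of_eStarLenPlusShape (hE : EStarLenPlusShape c' θ X 𝒱) (hC : ClosesByPositivityIn θ X 𝒱)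
    (h22 : Prop22i) (h23 : Lemma23 c') : Theorem2 :=
  Skeleton.theorem2_of_theorem1 (theorem1_of_eStarLenPlusShape hE hC h22 h23)

/-- **The ROBUST endgame (kernel implication, proved): E*-len⁺ priced at level `C` for the class + ONE design of the
class whose robust margin holds at level `C` (i.e. `C < C*(d)`, certified from the five atoms) + Prop. 2.2 (i) +
Lemma 2.3 ⇒ Theorem 1.** This is the sentence a B-len DESIGN-MAP row prices: everything except `EStarLenPlusBounded`
is either certified numerics (`RobustMargin`) or the manuscript's Part-1 claims. [cite: Zhang2022LandauSiegel, §2 p. 6, §7 Prop 7.1 (7.2)] -/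
theorem theorem1_of_eStarLenPlusBounded (hE : EStarLenPlusBounded c' θ C 𝒱) {u u' v v' : ℝ → ℂ}
    (hu : InClassPiece u u') (hv : 𝒱 v v') (hm : RobustMargin θ C u u' v v') (h22 : Prop22i)
    (h23 : Lemma23 c') : Theorem1 := by
  obtain ⟨X, _, hB, hS⟩ := hE
  obtain ⟨s, hs⟩ := exists_neg_of_offDiagBoundedOn hB hu hv hm
  exact theorem1_of_eStarLenPlusShape hS ⟨u, u', v, v', s, hu, hv, hs⟩ h22 h23

/-- … and Theorem 2. [cite: Zhang2022LandauSiegel, §1 Theorem 2] -/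
theorem theorem2_of_eStarLenPlusBounded (hE : EStarLenPlusBounded c' θ C 𝒱) {u u' v v' : ℝ → ℂ}
    (hu : InClassPiece u u') (hv : 𝒱 v v') (hm : RobustMargin θ C u u' v v') (h22 : Prop22i)
    (h23 : Lemma23 c') : Theorem2 :=
  Skeleton.theorem2_of_theorem1 (theorem1_of_eStarLenPlusBounded hE hu hv hm h22 h23)

/-- **E*-len⁺ priced is monotone in the level:** a smaller bound is a stronger statement. [cite: Zhang2022LandauSiegel, §7 (7.2) p.44] -/
theorem EStarLenPlusBounded.mono (hE : EStarLenPlusBounded c' θ C 𝒱) {C' : ℝ} (hle : C ≤ C') :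
    EStarLenPlusBounded c' θ C' 𝒱 := by
  obtain ⟨X, hF, hB, hS⟩ := hE
  exact ⟨X, hF, hB.mono hle, hS⟩

/-- **Obstruction bookkeeping (the smooth class, decided):** if the true off-diagonal input of the smooth class is
the invisible form, E*-len⁺ for `OverhangPiece θ` never closes, whatever the design (`not_closes_invisibleForm`);
B-len's live designs are therefore the NON-smooth classes `𝒱` (wall jumps, sharp cut-offs: (O1)).
[cite: Zhang2022LandauSiegel, §7 Prop 7.1 (7.2) p.44] -/
theorem not_closesByPositivityIn_invisibleForm (hθ : 1 ≤ θ) :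
    ¬ ClosesByPositivityIn θ (invisibleForm θ) (OverhangPiece θ) :=
  not_closes_invisibleForm hθ

end EStarLenPlus

/-! ### Part 6 — the REQUIRED STRENGTH `Creq_offdiag` in kernel form (the per-design price of the KILL wording
«no design closes without an E*-len-strength input»; cell OBJECTIVE.md §4.2, names adopted 2026-08-26) -/

section RequiredStrength

variable {θ C : ℝ} {X : PairFunctional} {u u' v v' : ℝ → ℂ}

/-- **STRENGTH BELOW REQUIREMENT at level `C`** — an ELEMENTARY inequality in the five certified atoms of a design
(`a = 𝔅(u)`, `c₀ = tailCoupling θ u v`, `k₀ = Re 𝔅_θ(v)`, `n₁ = inClassNorm u u′`, `n_θ = overhangNorm θ v v′`):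
`2C·n_θ² ≤ k₀ ∧ (|c₀| + C·n₁n_θ)² ≤ (k₀ − 2C·n_θ²)·a` — «even the most helpful `C`-bounded input cannot complete an
indefinite form here». The cell's currency `Creq_offdiag(d) := sup {C ≥ 0 : StrengthBelowReq θ C d}` (antitone:
`strengthBelowReq_mono`; `> 0` exactly when `d` does NOT close at `X = 0` with margin, `strengthBelowReq_zero_iff`;
closed form: with `m₀ = n₁n_θ`, the positive root of `m₀²C² + 2(|c₀|m₀ + n_θ²a)C + (|c₀|² − k₀a) = 0`, capped by
`k₀/(2n_θ²)`). Dual to `RobustMargin` (Part 3). [cite: Zhang2022LandauSiegel, §7 Prop 7.1 (7.2) p.44] -/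
def StrengthBelowReq (θ C : ℝ) (u u' v v' : ℝ → ℂ) : Prop :=
  2 * C * overhangNorm θ v v' ^ 2 ≤ (topDiagForm θ v v').re
  ∧ (‖tailCoupling θ u v‖ + C * inClassNorm u u' * overhangNorm θ v v') ^ 2
      ≤ ((topDiagForm θ v v').re - 2 * C * overhangNorm θ v v' ^ 2) * mainTermForm u u'

/-- **NO CLOSING BELOW THE REQUIRED STRENGTH (pointwise form):** if `𝔅(u) ≥ 0`, the two `C`-bounds hold AT THIS
DESIGN, and `StrengthBelowReq θ C` holds, then the two-piece constant is `≥ 0` at EVERY amplitude — no `C`-bounded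
off-diagonal input makes this design close. Mechanism: `|c| ≤ |c₀| + C·n₁n_θ`, `k ≥ k₀ − 2C·n_θ² ≥ 0`, then Part 0.
[cite: Zhang2022LandauSiegel, §7 Prop 7.1 (7.2) p.44] -/
theorem twoPieceMainTerm_nonneg_of_strengthBelowReq (ha : 0 ≤ mainTermForm u u')
    (hx : ‖X u u' v v'‖ ≤ C * inClassNorm u u' * overhangNorm θ v v')
    (hy : |(X v v' v v').re| ≤ C * overhangNorm θ v v' ^ 2) (hr : StrengthBelowReq θ C u u' v v') (s : ℂ) :
    0 ≤ twoPieceMainTerm θ X u u' v v' s := by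
  rw [twoPieceMainTerm_eq]
  obtain ⟨hk0, hreq⟩ := hr
  set a := mainTermForm u u' with ha_def
  set c := crossCoeff θ X u u' v v' with hc_def
  set k := overhangConst θ X v v' with hk_def
  set c₀ := tailCoupling θ u v with hc₀
  set M := ‖c₀‖ + C * inClassNorm u u' * overhangNorm θ v v' with hM
  set K := (topDiagForm θ v v').re - 2 * C * overhangNorm θ v v' ^ 2 with hK
  -- `k ≥ K ≥ 0`
  have hkK : K ≤ k := by
    have := (abs_le.mp hy).1
    simp only [hk_def, overhangConst, hK]
    linarith
  have hK0 : 0 ≤ K := by rw [hK]; linarith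
  -- `‖c‖ ≤ M`
  have hcM : ‖c‖ ≤ M := by
    have h1 : ‖c₀ + X u u' v v'‖ ≤ ‖c₀‖ + ‖X u u' v v'‖ := norm_add_le _ _
    have h2 : c = c₀ + X u u' v v' := rfl
    rw [h2, hM]
    linarith
  have hcsq : ‖c‖ ^ 2 ≤ K * a := by
    calc ‖c‖ ^ 2 ≤ M ^ 2 := pow_le_pow_left₀ (norm_nonneg _) hcM 2
      _ ≤ K * a := hreq
  rcases ha.lt_or_eq with hpos | hzero
  · -- `a > 0`: Part 0 with `‖c‖² ≤ K·a ≤ k·a`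
    exact quadratic_nonneg_of_pos hpos (hcsq.trans (mul_le_mul_of_nonneg_right hkK ha)) s
  · -- `a = 0`: then `c = 0` and `q(s) = k ≥ 0`
    have hc0 : c = 0 := by
      have : ‖c‖ ^ 2 ≤ 0 := by rw [← hzero, mul_zero] at hcsq; exact hcsq
      have : ‖c‖ = 0 := by nlinarith [norm_nonneg c]
      exact norm_eq_zero.mp this
    rw [← hzero, hc0]
    simp
    linarith

/-- **NO CLOSING BELOW THE REQUIRED STRENGTH (class form):** in a world whose off-diagonal input is `C`-bounded on
the class, a design of the class with `StrengthBelowReq θ C` never closes by positivity — the kernel meaning of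
`C ≤ Creq_offdiag(d)`. [cite: Zhang2022LandauSiegel, §7 Prop 7.1 (7.2) p.44] -/
theorem not_closes_of_strengthBelowReq {𝒱 : (ℝ → ℂ) → (ℝ → ℂ) → Prop} (hB : OffDiagBoundedOn θ C X 𝒱)
    (hu : InClassPiece u u') (hv : 𝒱 v v') (hr : StrengthBelowReq θ C u u' v v') :
    ¬ ∃ s : ℂ, twoPieceMainTerm θ X u u' v v' s < 0 := by
  rintro ⟨s, hs⟩
  exact not_lt.2 (twoPieceMainTerm_nonneg_of_strengthBelowReq (mainTermForm_nonneg_of_isH1 hu.kinked.isH1)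
    (hB u u' v v' hu hv).1 (hB u u' v v' hu hv).2 hr s) hs

/-- **`StrengthBelowReq` is antitone in `C`** (for `𝔅(u) ≥ 0`, `0 ≤ C'`): the admissible levels form an initial
segment, so `Creq_offdiag(d)` is certified by bisection. [cite: Zhang2022LandauSiegel, §7 (7.2) p.44] -/
theorem strengthBelowReq_mono (ha : 0 ≤ mainTermForm u u') {C C' : ℝ} (hC' : 0 ≤ C') (hle : C' ≤ C)
    (h : StrengthBelowReq θ C u u' v v') : StrengthBelowReq θ C' u u' v v' := by
  obtain ⟨hk0, hreq⟩ := h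
  have hn1 := inClassNorm_nonneg u u'
  have hn2 := overhangNorm_nonneg θ v v'
  have hm : C' * inClassNorm u u' * overhangNorm θ v v' ≤ C * inClassNorm u u' * overhangNorm θ v v' := by
    rw [mul_assoc, mul_assoc]; exact mul_le_mul_of_nonneg_right hle (mul_nonneg hn1 hn2)
  have hK : (topDiagForm θ v v').re - 2 * C * overhangNorm θ v v' ^ 2
      ≤ (topDiagForm θ v v').re - 2 * C' * overhangNorm θ v v' ^ 2 := by
    nlinarith [sq_nonneg (overhangNorm θ v v')]
  refine ⟨by nlinarith [sq_nonneg (overhangNorm θ v v')], ?_⟩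
  have hM0 : 0 ≤ ‖tailCoupling θ u v‖ + C' * inClassNorm u u' * overhangNorm θ v v' :=
    add_nonneg (norm_nonneg _) (mul_nonneg (mul_nonneg hC' hn1) hn2)
  calc (‖tailCoupling θ u v‖ + C' * inClassNorm u u' * overhangNorm θ v v') ^ 2
      ≤ (‖tailCoupling θ u v‖ + C * inClassNorm u u' * overhangNorm θ v v') ^ 2 :=
        pow_le_pow_left₀ hM0 (by linarith) 2
    _ ≤ ((topDiagForm θ v v').re - 2 * C * overhangNorm θ v v' ^ 2) * mainTermForm u u' := hreq
    _ ≤ ((topDiagForm θ v v').re - 2 * C' * overhangNorm θ v v' ^ 2) * mainTermForm u u' :=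
        mul_le_mul_of_nonneg_right hK ha

/-- at level `C = 0` the requirement is the completed Cauchy–Schwarz inequality of the continued calculus at this
design, `|c₀|² ≤ k₀·a` with `k₀ ≥ 0` (the design does not close at `X = 0`). [cite: Zhang2022LandauSiegel, §7 (7.2) p.44] -/
theorem strengthBelowReq_zero_iff :
    StrengthBelowReq θ 0 u u' v v' ↔
      0 ≤ (topDiagForm θ v v').re ∧ ‖tailCoupling θ u v‖ ^ 2 ≤ (topDiagForm θ v v').re * mainTermForm u u' := by
  simp [StrengthBelowReq]

/-- **the two currencies never overlap:** a design cannot be both robustly closing and below requirement at the same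
level (for `𝔅(u) ≥ 0` and some input obeying the bounds — e.g. `X = 0` at `C ≥ 0`). Stated through the continued
calculus: `RobustMargin θ C` and `StrengthBelowReq θ C` are jointly impossible when `C ≥ 0`.
[cite: Zhang2022LandauSiegel, §7 (7.2) p.44] -/
theorem not_robustMargin_of_strengthBelowReq (hu : InClassPiece u u') (hC : 0 ≤ C)
    (hr : StrengthBelowReq θ C u u' v v') : ¬ RobustMargin θ C u u' v v' := by
  intro hm
  obtain ⟨s, hs⟩ := exists_neg_of_robustMargin (X := 0) (mainTermForm_nonneg_of_isH1 hu.kinked.isH1)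
    (by simpa using mul_nonneg (mul_nonneg hC (inClassNorm_nonneg u u')) (overhangNorm_nonneg θ v v'))
    (by simpa using mul_nonneg hC (sq_nonneg (overhangNorm θ v v'))) hm
  exact not_lt.2 (twoPieceMainTerm_nonneg_of_strengthBelowReq (mainTermForm_nonneg_of_isH1 hu.kinked.isH1)
    (by simpa using mul_nonneg (mul_nonneg hC (inClassNorm_nonneg u u')) (overhangNorm_nonneg θ v v'))
    (by simpa using mul_nonneg hC (sq_nonneg (overhangNorm θ v v'))) hr s) hs

end RequiredStrength

end KnifeEdge

end Literature.NumberTheory.LFunctions.Zhang2022
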